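import Summits.CriticalPhenomena.CardyFormulaZ2.Theses.CardyMeckeFlip
import Summits.CriticalPhenomena.CardyFormulaZ2.Theorems.CardyMeckeFlipZ2LimitsSymmetricRotationInvariantLimits
import Summits.CriticalPhenomena.CardyFormulaZ2.Theorems.CardyMeckeFlipZ2LimitsSymmetricIsometryOfRotation
import Summits.CriticalPhenomena.CardyFormulaZ2.Theorems.CardyMeckeFlipZ2LimitsSymmetricDualExclusion
import Summits.CriticalPhenomena.CardyFormulaZ2.Theorems.CardyMeckeFlipZ2LimitsSymmetricOneQuadDualityGe
import Summits.CriticalPhenomena.CardyFormulaZ2.Theorems.CardyMeckeFlipZ2LimitsSymmetricCrossedEventEqOfSides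
import Summits.CriticalPhenomena.CardyFormulaZ2.Theorems.CardyMeckeFlipZ2LimitsSymmetricSelfDualMarginalsOf
import Summits.CriticalPhenomena.CardyFormulaZ2.Theorems.CardyMeckeFlipZ2LimitsSymmetricLatticeRSWQuads
import Literature.Probability.Percolation.QuadCrossingSubseqLimits
import Literature.Probability.Percolation.QuadCrossingContinuityEventsProofs
import HarnessLib

/-!
# `Z2LimitsSymmetric` (stmt-CriticalPhenomena-14827): the crux modulo DKKMO's rotation-invariance theorem

Crux `Z2LimitsSymmetric` of route `CardyMeckeFlip`, sub-problem `CardyFormulaZ2` — "the non-flip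
hypotheses of `MeckeRigidity`": every subsequential quad-crossing scaling limit
`μ ∈ Λ = subseqQuadLimits univ` of critical bond percolation on `δℤ²` in the Schramm–Smirnov space
`ℋ_ℂ = QuadConfig univ` is (P) a probability law, (E2) invariant under every isometry of `ℂ`,
(D) exactly self-dual on finite-dimensional crossing marginals, (RSW) bounded below by one `c > 0` on
every `3a × a` rectangle quad crossed the long way.

This file assembles the line `registered` (`Cruxes/Z2LimitsSymmetric/Lines/birth.lean`) from its landed
stubs (all in namespace `Summit.CriticalPhenomena.CardyFormulaZ2.Cruxes.Z2LimitsSymmetric`):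

* (P) is the tree theorem `isProbabilityMeasure_of_isSubseqQuadLimit`;
* (D) is UNCONDITIONAL: `z2Limits_selfDualMarginals` = `stub_selfDualMarginals_of stub_dualExclusion
  stub_oneQuadDualityGe stub_crossedEvent_eq_of_sides` (lattice exclusion with the half-mesh-shifted
  dual picture, the `≥` half of one-quad duality from `prob_not_crossed_le_z2QuadLaw`, side-dependence
  of crossing events, and the coupling/total-variation passage to the limit through Schramm–Smirnov's
  Lemma 5.1, proved in the tree);
* (RSW) is UNCONDITIONAL: `z2Limits_rsw` = `stub_latticeRSWQuads` pushed through the closed-set half of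
  the portmanteau theorem (`le_measureReal_of_isClosed_of_eventually`);
* (E2) GIVEN rotation invariance is `stub_isometryOfRotation` (translations: lattice + continuity;
  reflection: lattice; generation of `E(2)`: Mazur–Ulam);
* rotation invariance itself is the theorem of Duminil-Copin–Kozlowski–Krachun–Manolescu–Oulamara
  (arXiv:2012.11672, Thm. 1.2): `stub_rotationInvariantLimits_of_dkkmo` derives it from the named
  Literature fact `dkkmo_theorem_1_2_schrammSmirnov` through the tree's ℋ-space passage
  `rotationInput_of_dkkmo_theorem_1_2_schrammSmirnov`.

Hence `Z2LimitsSymmetric_of_rotationInvariance` (the crux from the bare rotation-invariance statement,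
= stub S1 = item `CardySelfRefinement.RotationInput`, stmt-CriticalPhenomena-10270) and
**`Z2LimitsSymmetric_of_dkkmo : dkkmo_theorem_1_2_schrammSmirnov → Z2LimitsSymmetric`** — a
CONDITIONAL result: the crux is closed modulo exactly DKKMO's Theorem 1.2 (`d_SS` half, `q = 1`,
`Ω = ℝ²`), its cited debt.  STATUS: conditional-result; the item stays open until that fact is
discharged.

## References

* [DKKMO2020Rotational] H. Duminil-Copin, K. K. Kozlowski, D. Krachun, I. Manolescu, M. Oulamara,
  *Rotational invariance in critical planar lattice models*, arXiv:2012.11672, Thm. 1.2.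
* [SchrammSmirnov2011] O. Schramm, S. Smirnov, Ann. Probab. 39 (2011) 1768–1814, §1.1, §1.3–1.4,
  Lemma 5.1, Cor. 5.2.
* [GrimmettPercolation1999] G. Grimmett, *Percolation*, 2nd ed. (1999), §11.2 (duality), §11.7 (RSW).
* [GarbanPeteSchramm2013Pivotal] C. Garban, G. Pete, O. Schramm, arXiv:1008.1378, §2.3.
-/

noncomputable section

open MeasureTheory Filter Set Topology
open scoped ENNReal NNReal
open Literature.Probability.Percolation Literature.Probability.Percolation.QuadCrossing
open Summit.CriticalPhenomena.CardyFormulaZ2.Cruxes.Z2LimitsSymmetric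

namespace Summit.CriticalPhenomena.CardyFormulaZ2.Theorems

/-! ### Portmanteau step: a lattice lower bound holding for all small meshes survives in every sublimit -/

/-- **Closed events keep lattice lower bounds in the limit.**  If `μ ∈ Λ`, `F ⊆ ℋ_ℂ` is closed
in `𝒯`, and a real `c` bounds `μ_δ(F)` from below for all small `δ > 0`, then `c ≤ μ(F)`: along the
defining meshes `δₖ → 0⁺` of `μ` (`isSubseqQuadLimit_iff`) the bound holds eventually, and the
closed-set half of the portmanteau theorem on the metrisable `ℋ_ℂ` (`QuadConfig.hasOuterApproxClosed`,
`FiniteMeasure.limsup_measure_closed_le_of_tendsto`) gives `limsup μ_{δₖ}(F) ≤ μ(F)`.  (The planner's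
lemma of the birth skeleton, for a general closed event.) -/
theorem le_measureReal_of_isClosed_of_eventually
    {μ : FiniteMeasure (QuadConfig (Set.univ : Set ℂ))} (hμ : μ ∈ subseqQuadLimits (Set.univ : Set ℂ))
    {F : Set (QuadConfig (Set.univ : Set ℂ))} (hF : IsClosed F) {c : ℝ}
    (h : ∀ᶠ δ in nhdsWithin (0 : ℝ) (Set.Ioi 0),
      c ≤ ((z2QuadLaw (Set.univ : Set ℂ) δ : FiniteMeasure (QuadConfig (Set.univ : Set ℂ))) :
        Measure (QuadConfig (Set.univ : Set ℂ))).real F) :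
    c ≤ (μ : Measure (QuadConfig (Set.univ : Set ℂ))).real F := by
  haveI : HasOuterApproxClosed (QuadConfig (Set.univ : Set ℂ)) :=
    QuadConfig.hasOuterApproxClosed isOpen_univ univ_nonempty
  obtain ⟨δs, hpos, hδ0, hlim⟩ := (isSubseqQuadLimit_iff Set.univ μ).mp hμ
  have hδs : Tendsto δs atTop (nhdsWithin (0 : ℝ) (Set.Ioi 0)) :=
    tendsto_nhdsWithin_iff.mpr ⟨hδ0, Eventually.of_forall fun k => hpos k⟩
  have hev : ∀ᶠ k in atTop, ENNReal.ofReal c ≤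
      ((z2QuadLaw (Set.univ : Set ℂ) (δs k) : FiniteMeasure (QuadConfig (Set.univ : Set ℂ))) :
        Measure (QuadConfig (Set.univ : Set ℂ))) F := by
    filter_upwards [hδs.eventually h] with k hk
    exact (ENNReal.ofReal_le_iff_le_toReal (measure_ne_top _ _)).mpr hk
  have hlimsup : atTop.limsup (fun k =>
      ((z2QuadLaw (Set.univ : Set ℂ) (δs k) : FiniteMeasure (QuadConfig (Set.univ : Set ℂ))) :
        Measure (QuadConfig (Set.univ : Set ℂ))) F) ≤
      (μ : Measure (QuadConfig (Set.univ : Set ℂ))) F :=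
    FiniteMeasure.limsup_measure_closed_le_of_tendsto hlim hF
  have hle : ENNReal.ofReal c ≤ (μ : Measure (QuadConfig (Set.univ : Set ℂ))) F :=
    (le_limsup_of_frequently_le hev.frequently).trans hlimsup
  exact (ENNReal.ofReal_le_iff_le_toReal (measure_ne_top _ _)).mp hle

/-! ### The unconditional clauses -/

/-- **(D), unconditional: exact self-duality of the finite-dimensional crossing marginals of every
`μ ∈ Λ`.**  For quads `Q_i` and their transposes `Qt_i` (same carrier, sides advanced by one) and
every set of patterns `A`, `μ {S | {i | Q_i ∈ S} ∈ A} = μ {S | {i | Qt_i ∉ S} ∈ A}`. -/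
theorem z2Limits_selfDualMarginals :
    ∀ μ ∈ subseqQuadLimits (Set.univ : Set ℂ),
      ∀ (n : ℕ) (Q Qt : Fin n → Quad (Set.univ : Set ℂ)),
        (∀ i, (Qt i).carrier = (Q i).carrier ∧ (Qt i).side 0 = (Q i).side 1 ∧
          (Qt i).side 1 = (Q i).side 2 ∧ (Qt i).side 2 = (Q i).side 3 ∧
          (Qt i).side 3 = (Q i).side 0) →
        ∀ A : Set (Set (Fin n)),
          ((μ : MeasureTheory.FiniteMeasure (QuadConfig (Set.univ : Set ℂ))) :
              MeasureTheory.Measure (QuadConfig (Set.univ : Set ℂ))) {S | {i | Q i ∈ S} ∈ A} =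
            ((μ : MeasureTheory.FiniteMeasure (QuadConfig (Set.univ : Set ℂ))) :
              MeasureTheory.Measure (QuadConfig (Set.univ : Set ℂ))) {S | {i | Qt i ∉ S} ∈ A} :=
  stub_selfDualMarginals_of stub_dualExclusion stub_oneQuadDualityGe stub_crossedEvent_eq_of_sides

/-- **(RSW), unconditional: one constant `c > 0` below the crossing probability of every `3a × a`
rectangle quad (short sides `0`/`2`) under every `μ ∈ Λ`** (`stub_latticeRSWQuads` through the
closed-set portmanteau step). -/
theorem z2Limits_rsw :
    ∃ c : ℝ, 0 < c ∧ ∀ μ ∈ subseqQuadLimits (Set.univ : Set ℂ), ∀ (a x y : ℝ), 0 < a →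
      ∀ Q : Quad (Set.univ : Set ℂ),
        Q.carrier = {w : ℂ | x ≤ w.re ∧ w.re ≤ x + 3 * a ∧ y ≤ w.im ∧ w.im ≤ y + a} →
        Q.side 0 = {w : ℂ | w.re = x ∧ y ≤ w.im ∧ w.im ≤ y + a} →
        Q.side 2 = {w : ℂ | w.re = x + 3 * a ∧ y ≤ w.im ∧ w.im ≤ y + a} →
        c ≤ ((μ : MeasureTheory.FiniteMeasure (QuadConfig (Set.univ : Set ℂ))) :
          MeasureTheory.Measure (QuadConfig (Set.univ : Set ℂ))).real (QuadConfig.crossedEvent Q) := by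
  obtain ⟨c, hc, hlat⟩ := stub_latticeRSWQuads
  exact ⟨c, hc, fun μ hμ a x y ha Q hQc hQ0 hQ2 =>
    le_measureReal_of_isClosed_of_eventually hμ (QuadConfig.isClosed_crossedEvent Q)
      (hlat a x y ha Q hQc hQ0 hQ2)⟩

/-! ### The crux, modulo rotation invariance / modulo DKKMO's Theorem 1.2 -/

/-- **`Z2LimitsSymmetric` from rotation invariance of sublimits** (the statement of stub S1 =
item `CardySelfRefinement.RotationInput`, stmt-CriticalPhenomena-10270): everything else is proved. -/
theorem Z2LimitsSymmetric_of_rotationInvariance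
    (hrot : ∀ μ ∈ subseqQuadLimits (Set.univ : Set ℂ), ∀ α : ℝ,
      isometryLaw (rotation (Circle.exp α)).toIsometryEquiv μ = μ) :
    Summit.CriticalPhenomena.CardyFormulaZ2.Theses.CardyMeckeFlip.Z2LimitsSymmetric := by
  intro μ hμ
  obtain ⟨c, hc, hrsw⟩ := z2Limits_rsw
  exact ⟨isProbabilityMeasure_of_isSubseqQuadLimit isOpen_univ hμ,
    stub_isometryOfRotation μ hμ (hrot μ hμ), z2Limits_selfDualMarginals μ hμ,
    c, hc, fun a x y ha Q hQc hQ0 hQ2 => hrsw μ hμ a x y ha Q hQc hQ0 hQ2⟩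

/-- Conversely, the crux contains rotation invariance of sublimits (clause (E2) at the rotations), so
**`Z2LimitsSymmetric` is EQUIVALENT to stub S1** given the rest of this file: the crux is exactly as
hard as DKKMO's theorem read in `ℋ_ℂ`. -/
theorem rotationInvariance_of_Z2LimitsSymmetric
    (h : Summit.CriticalPhenomena.CardyFormulaZ2.Theses.CardyMeckeFlip.Z2LimitsSymmetric) :
    ∀ μ ∈ subseqQuadLimits (Set.univ : Set ℂ), ∀ α : ℝ,
      isometryLaw (rotation (Circle.exp α)).toIsometryEquiv μ = μ := by
  intro μ hμ α
  obtain ⟨-, hE2, -, -⟩ := h μ hμ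
  apply FiniteMeasure.toMeasure_injective
  rw [isometryLaw, FiniteMeasure.toMeasure_map]
  exact hE2 _

/-- `Z2LimitsSymmetric ↔` rotation invariance of every `μ ∈ Λ` (stub S1 / item `RotationInput`). -/
theorem Z2LimitsSymmetric_iff_rotationInvariance :
    Summit.CriticalPhenomena.CardyFormulaZ2.Theses.CardyMeckeFlip.Z2LimitsSymmetric ↔
      ∀ μ ∈ subseqQuadLimits (Set.univ : Set ℂ), ∀ α : ℝ,
        isometryLaw (rotation (Circle.exp α)).toIsometryEquiv μ = μ :=
  ⟨rotationInvariance_of_Z2LimitsSymmetric, Z2LimitsSymmetric_of_rotationInvariance⟩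

/-- **`Z2LimitsSymmetric`, CONDITIONAL on DKKMO's Theorem 1.2** (`dkkmo_theorem_1_2_schrammSmirnov`,
arXiv:2012.11672 Thm. 1.2, `d_SS` half, `q = 1`, `Ω = ℝ²` — the published rotation-invariance
theorem, the crux's cited debt): rotation invariance of sublimits is
`stub_rotationInvariantLimits_of_dkkmo`, the rest is `Z2LimitsSymmetric_of_rotationInvariance`. -/
theorem Z2LimitsSymmetric_of_dkkmo (hSS : dkkmo_theorem_1_2_schrammSmirnov) :
    Summit.CriticalPhenomena.CardyFormulaZ2.Theses.CardyMeckeFlip.Z2LimitsSymmetric :=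
  Z2LimitsSymmetric_of_rotationInvariance (stub_rotationInvariantLimits_of_dkkmo hSS)

end Summit.CriticalPhenomena.CardyFormulaZ2.Theorems

end
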